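import Mathlib

/-!
# `IsometryMove`, line `bruhat-inversion-chain`: the Bruhat factorisation on the big cell `c ≠ 0`

Stub `stub_bruhatFactorisation` of the crux `IsometryMove` (stmt-KontsevichZagierPeriods-3471, route
HyperbolicBloch). In the upper half-space `ℝ³` (coordinates `p 0 = x`, `p 1 = y`, `p 2 = t > 0`)
write `w = p 0 + i·ε·p 1`, `u = c·w + d`, `K = a·d − b·c` and `N = |u|² + |c|²·t²`. The typed
Poincaré extension of the Möbius map `w ↦ (a·w + b)/(c·w + d)` is

`g p = ( ((a·w + b)·ū + a·c̄·t²).re / N, ((a·w + b)·ū + a·c̄·t²).im / N, ‖K‖·t / N )`,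

and on the big Bruhat cell `c ≠ 0` it FACTORS pointwise on `{t > 0}` as `S₂ ∘ J ∘ S₁` with

* `S₁ p = (u.re, u.im, ‖c‖·t)` — the Poincaré extension of the similarity `w ↦ c·w + d`;
* `J q = (q₀, −q₁, q₂)/(q₀² + q₁² + q₂²)` — the Poincaré extension of `w ↦ 1/w`;
* `S₂ q = (((−K/c)·(q₀ + i·q₁) + a/c).re, (…).im, ‖−K/c‖·q₂)` — the Poincaré extension of the
  similarity `w ↦ (−K/c)·w + a/c`.

The proof is pure algebra: `|S₁ p|² = N` (`bruhat_sphere_radius`), so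
`J (S₁ p) = (u.re, −u.im, ‖c‖ t)/N`, whose first two coordinates form the complex number `ū/N`
(`bruhat_inverted_point`); the first two coordinates of both sides then agree by the Möbius
identity `((a·w + b)·ū + a·c̄·t²)/N = (−K/c)·(ū/N) + a/c` (`bruhat_moebius_identity`, i.e.
`c·((a·w + b)·ū + a·c̄·t²) = −K·ū + a·(u·ū + c·c̄·t²)` because `−K + a·u = c·(a·w + b)`), and the
heights agree because `‖−K/c‖·‖c‖ = ‖K‖` (`bruhat_height`).

References: R. Benedetti, C. Petronio, *Lectures on Hyperbolic Geometry* (1992), proof of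
Prop. A.3.5(2) ("if `c = 0` obvious; otherwise compose similarities with the inversion in the
sphere of centre `−d/c`").
-/

noncomputable section

namespace Summit.KontsevichZagierPeriods.HyperbolicBloch.IsometryMove

/-- Clearing the two denominators `N ≠ 0`, `c ≠ 0`: if `c·Z = −K·U + a·N` then
`Z/N = (−K/c)·(U/N) + a/c`. [folklore] -/
theorem bruhat_div_identity {Z K U a c N : ℂ} (hc : c ≠ 0) (hN : N ≠ 0)
    (key : c * Z = -K * U + a * N) : Z / N = -K / c * (U / N) + a / c := by
  field_simp
  linear_combination key

/-- The sum of squares of the coordinates of `S₁ p = (u.re, u.im, ‖c‖ t)` is `N = |u|² + |c|² t²`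
(the sphere of inversion read through `S₁`). [folklore] -/
theorem bruhat_sphere_radius (u c : ℂ) (t : ℝ) :
    u.re ^ 2 + u.im ^ 2 + (‖c‖ * t) ^ 2 = Complex.normSq u + Complex.normSq c * t ^ 2 := by
  rw [mul_pow, Complex.sq_norm, Complex.normSq_apply u]
  ring

/-- The first two coordinates of `J (S₁ p) = (u.re, −u.im, ‖c‖ t)/N`, read as a complex number
(with the trivial mirror factor `1` of `S₂`), form `ū / N`. [folklore] -/
theorem bruhat_inverted_point (u : ℂ) (N : ℝ) :
    (Complex.mk (u.re / N) (1 * (-u.im / N))) = (starRingEnd ℂ) u / (N : ℂ) := by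
  apply Complex.ext
  · rw [Complex.div_ofReal_re, Complex.conj_re]
  · rw [Complex.div_ofReal_im, Complex.conj_im, one_mul]

/-- `N = |u|² + |c|² t²` is positive as soon as `c ≠ 0` and `t > 0`. [folklore] -/
theorem bruhat_N_pos {c : ℂ} (u : ℂ) {t : ℝ} (hc : c ≠ 0) (ht : 0 < t) :
    0 < Complex.normSq u + Complex.normSq c * t ^ 2 :=
  add_pos_of_nonneg_of_pos (Complex.normSq_nonneg u)
    (mul_pos (Complex.normSq_pos.mpr hc) (pow_pos ht 2))

/-- The real number `N = |u|² + |c|² t²`, cast to `ℂ`, is `u·ū + c·c̄·t²`. [folklore] -/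
theorem bruhat_normSq_cast (u c : ℂ) (t : ℝ) :
    ((Complex.normSq u + Complex.normSq c * t ^ 2 : ℝ) : ℂ) =
      u * (starRingEnd ℂ) u + c * (starRingEnd ℂ) c * (t : ℂ) ^ 2 := by
  rw [Complex.ofReal_add, Complex.ofReal_mul, Complex.ofReal_pow, Complex.mul_conj,
    Complex.mul_conj]

/-- The Möbius identity behind the Bruhat factorisation, extended to `ℍ³`: with `u = c·w + d`,
`K = a·d − b·c`, `N = |u|² + |c|² t²` and `c ≠ 0`, `t > 0`,
`((a·w + b)·ū + a·c̄·t²)/N = (−K/c)·(ū/N) + a/c` — on the boundary `t = 0` this is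
`(a·w + b)/(c·w + d) = a/c − (K/c)·(c·w + d)⁻¹`. It reduces to the polynomial identity
`c·((a·w + b)·ū + a·c̄·t²) = −K·ū + a·(u·ū + c·c̄·t²)`, i.e. `−K + a·u = c·(a·w + b)`.
[cite: BenedettiPetronio1992, A.3.5] -/
theorem bruhat_moebius_identity (a b c d w : ℂ) (t : ℝ) (hc : c ≠ 0) (ht : 0 < t) :
    ((a * w + b) * (starRingEnd ℂ) (c * w + d) + a * (starRingEnd ℂ) c * (t : ℂ) ^ 2) /
        ((Complex.normSq (c * w + d) + Complex.normSq c * t ^ 2 : ℝ) : ℂ) =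
      -(a * d - b * c) / c * ((starRingEnd ℂ) (c * w + d) /
        ((Complex.normSq (c * w + d) + Complex.normSq c * t ^ 2 : ℝ) : ℂ)) + a / c := by
  have hN : ((Complex.normSq (c * w + d) + Complex.normSq c * t ^ 2 : ℝ) : ℂ) ≠ 0 :=
    Complex.ofReal_ne_zero.mpr (bruhat_N_pos (c * w + d) hc ht).ne'
  refine bruhat_div_identity hc hN ?_
  rw [bruhat_normSq_cast]
  ring

/-- The heights agree: `‖−K/c‖ · (‖c‖·t / N) = ‖K‖·t / N` for `c ≠ 0`. [folklore] -/
theorem bruhat_height (K : ℂ) {c : ℂ} (hc : c ≠ 0) (t N : ℝ) :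
    ‖-K / c‖ * (‖c‖ * t / N) = ‖K‖ * t / N := by
  have hc' : ‖c‖ ≠ 0 := norm_ne_zero_iff.mpr hc
  rw [norm_div, norm_neg, div_mul_eq_mul_div, div_eq_iff hc']
  ring

/-- **Bruhat factorisation, pointwise form in the variables `w = p 0 + iε·p 1`, `t = p 2`.**
For `c ≠ 0` and `t > 0` the typed Poincaré extension `g` equals `S₂ (J (S₁ p))` with the three
maps written out (`S₁ p = (u.re, u.im, ‖c‖ t)` already substituted into `J`, and `J (S₁ p)` into
`S₂`). [cite: BenedettiPetronio1992, A.3.5] -/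
theorem bruhat_pointwise (a b c d w : ℂ) (t : ℝ) (hc : c ≠ 0) (ht : 0 < t) :
    (![((a * w + b) * (starRingEnd ℂ) (c * w + d) + a * (starRingEnd ℂ) c * (t : ℂ) ^ 2).re /
        (Complex.normSq (c * w + d) + Complex.normSq c * t ^ 2),
      ((a * w + b) * (starRingEnd ℂ) (c * w + d) + a * (starRingEnd ℂ) c * (t : ℂ) ^ 2).im /
        (Complex.normSq (c * w + d) + Complex.normSq c * t ^ 2),
      ‖a * d - b * c‖ * t / (Complex.normSq (c * w + d) + Complex.normSq c * t ^ 2)] : Fin 3 → ℝ) =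
    ![(-(a * d - b * c) / c *
            Complex.mk ((c * w + d).re / ((c * w + d).re ^ 2 + (c * w + d).im ^ 2 + (‖c‖ * t) ^ 2))
              (1 * (-(c * w + d).im / ((c * w + d).re ^ 2 + (c * w + d).im ^ 2 + (‖c‖ * t) ^ 2))) +
          a / c).re,
      (-(a * d - b * c) / c *
            Complex.mk ((c * w + d).re / ((c * w + d).re ^ 2 + (c * w + d).im ^ 2 + (‖c‖ * t) ^ 2))
              (1 * (-(c * w + d).im / ((c * w + d).re ^ 2 + (c * w + d).im ^ 2 + (‖c‖ * t) ^ 2))) +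
          a / c).im,
      ‖-(a * d - b * c) / c‖ *
        (‖c‖ * t / ((c * w + d).re ^ 2 + (c * w + d).im ^ 2 + (‖c‖ * t) ^ 2))] := by
  rw [bruhat_sphere_radius, bruhat_inverted_point, ← bruhat_moebius_identity a b c d w t hc ht,
    Complex.div_ofReal_re, Complex.div_ofReal_im, bruhat_height _ hc]

/-- **Bruhat factorisation, big cell `c ≠ 0`** (stub `stub_bruhatFactorisation` of line
`bruhat-inversion-chain`). On `{t > 0}` the typed Poincaré extension of
`w ↦ (a·w + b)/(c·w + d)` is the composite `S(−(ad−bc)/c, a/c, 1) ∘ J ∘ S(c, d, ε)` of two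
boundary-fixing similarities and the unit inversion composed with the mirror
(`(aw+b)/(cw+d) = a/c − ((ad−bc)/c)·(cw+d)⁻¹`). [cite: BenedettiPetronio1992, A.3.5] -/
theorem stub_bruhatFactorisation : ∀ (a b c d : ℂ) (ε : ℝ), c ≠ 0 → ∀ (S₁ J S₂ : (Fin 3 → ℝ) → (Fin 3 → ℝ)), (∀ p, S₁ p = ![(c * (Complex.mk (p 0) (ε * p 1)) + d).re, (c * (Complex.mk (p 0) (ε * p 1)) + d).im, ‖c‖ * p 2]) → (∀ p, J p = ![p 0 / (p 0 ^ 2 + p 1 ^ 2 + p 2 ^ 2), -p 1 / (p 0 ^ 2 + p 1 ^ 2 + p 2 ^ 2), p 2 / (p 0 ^ 2 + p 1 ^ 2 + p 2 ^ 2)]) → (∀ p, S₂ p = ![((-(a * d - b * c) / c) * (Complex.mk (p 0) (1 * p 1)) + a / c).re, ((-(a * d - b * c) / c) * (Complex.mk (p 0) (1 * p 1)) + a / c).im, ‖-(a * d - b * c) / c‖ * p 2]) → ∀ (p : Fin 3 → ℝ), 0 < p 2 → (![((a * (Complex.mk (p 0) (ε * p 1)) + b) * (starRingEnd ℂ) (c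 * (Complex.mk (p 0) (ε * p 1)) + d) + a * (starRingEnd ℂ) c * (p 2 : ℂ) ^ 2).re / (Complex.normSq (c * (Complex.mk (p 0) (ε * p 1)) + d) + Complex.normSq c * p 2 ^ 2), ((a * (Complex.mk (p 0) (ε * p 1)) + b) * (starRingEnd ℂ) (c * (Complex.mk (p 0) (ε * p 1)) + d) + a * (starRingEnd ℂ) c * (p 2 : ℂ) ^ 2).im / (Complex.normSq (c * (Complex.mk (p 0) (ε * p 1)) + d) + Complex.normSq c * p 2 ^ 2), ‖a * d - b * c‖ * p 2 / (Complex.normSq (c * (Complex.mk (p 0) (ε * p 1)) + d) + Complex.normSq c * p 2 ^ 2)] : Fin 3 → ℝ) = S₂ (J (S₁ p)) := by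
  intro a b c d ε hc S₁ J S₂ hS₁ hJ hS₂ p hp
  rw [hS₂, hJ, hS₁]
  simp only [Matrix.cons_val_zero, Matrix.cons_val_one, Matrix.cons_val_two, Matrix.head_cons,
    Matrix.tail_cons]
  exact bruhat_pointwise a b c d _ (p 2) hc hp

end Summit.KontsevichZagierPeriods.HyperbolicBloch.IsometryMove

end
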